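import Mathlib
import Literature.NumberTheory.Automorphic.HilbertModularFormQExpansion
import Literature.NumberTheory.Automorphic.CongruenceSubgroupPropertySL2Field

/-!
# Translations and diagonal units in `g⁻¹ Γ(𝔫) g` for a cusp `g ∈ SL₂(F)`

Stub `stub_conj_principal_congruence` (M-A3) for line Sketch-ideate-r1-k1 of the crux
`HilbertIntegralOverconvergentIsCongruence` (stmt-Langlands-8485).  Section M of the line proves the
Koecher principle (Freitag, *Hilbert Modular Forms*, Ch. I Prop. 4.9 Cor.) at every cusp `g ∈ SL₂(F)`
of a form for `Γ ⊇ Γ(𝔫)`; the slash `f|_k g` transforms under `g⁻¹ Γ(𝔫) g`, and this file supplies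
the elements that conjugate is guaranteed to contain: the translations `t = (1 a; 0 1)`, `a` in a
non-zero ideal `𝔪`, and the diagonal units `t = diag(ε, ε⁻¹)`, `ε ≡ 1 (mod 𝔪)`, each in the form
`γ g = g t` with `γ ∈ Γ(𝔫)` (as elements of `SL₂(F)`).  Proof: the tree's
`SL2Rel.exists_conj_Gamma` (file `CongruenceSubgroupPropertySL2Field.lean`: for `𝔪 = D²𝔫`, `D` a
common denominator of the entries of `g`, one has `g Γ(𝔪) g⁻¹ ⊆ Γ(𝔫)` inside `SL₂(F)`), applied to
the elementary matrix `E₁₂(a) ∈ Γ(𝔪)` and to `diag(ε, ε⁻¹) ∈ Γ(𝔪)` (as `ε⁻¹ - 1 = -ε⁻¹ (ε - 1)`).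
-/

set_option linter.dupNamespace false

noncomputable section

namespace Summit.Langlands.Langlands.Theorems.HilbertIntegralOverconvergentIsCongruence

open MeasureTheory Complex NumberField
open Literature.NumberTheory.Automorphic Literature.NumberTheory.Automorphic.HilbertModular
open scoped MatrixGroups

/-- For a unit `ε ≡ 1 (mod 𝔪)` also `ε⁻¹ ≡ 1 (mod 𝔪)`, as `ε⁻¹ - 1 = -ε⁻¹ (ε - 1)`. -/
theorem cpc_units_inv_sub_one_mem {R : Type*} [CommRing R] {𝔪 : Ideal R} {ε : Rˣ}
    (hε : (ε : R) - 1 ∈ 𝔪) : ((ε⁻¹ : Rˣ) : R) - 1 ∈ 𝔪 := by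
  have hinv : ((ε⁻¹ : Rˣ) : R) - 1 = -((ε⁻¹ : Rˣ) : R) * ((ε : R) - 1) := by
    linear_combination ε.inv_mul
  rw [hinv]
  exact 𝔪.mul_mem_left _ hε

/-- `det (ε 0; 0 ε⁻¹) = 1` for a unit `ε` of a commutative ring. -/
theorem cpc_det_diagUnit {R : Type*} [CommRing R] (ε : Rˣ) :
    Matrix.det !![(ε : R), 0; 0, ((ε⁻¹ : Rˣ) : R)] = 1 := by
  rw [Matrix.det_fin_two_of, Units.mul_inv, zero_mul, sub_zero]

/-- `diag(ε, ε⁻¹) ∈ Γ(𝔪)` for a unit `ε ≡ 1 (mod 𝔪)`. -/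
theorem cpc_diagUnit_mem_Gamma {R : Type*} [CommRing R] {𝔪 : Ideal R} {ε : Rˣ}
    (hε : (ε : R) - 1 ∈ 𝔪) :
    (⟨!![(ε : R), 0; 0, ((ε⁻¹ : Rˣ) : R)], cpc_det_diagUnit ε⟩ : SL(2, R)) ∈ Bianchi.Gamma 𝔪 :=
  SL2Rel.mem_Gamma.2 ⟨𝔪.zero_mem, 𝔪.zero_mem, hε, cpc_units_inv_sub_one_mem hε⟩

/-- The image of `diag(ε, ε⁻¹) ∈ SL₂(𝓞 F)` in `SL₂(F)` is the matrix `(ε 0; 0 ε⁻¹)`. -/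
theorem cpc_coe_toSL2F_diagUnit {F : Type*} [Field F] [NumberField F] (ε : (𝓞 F)ˣ) :
    ((toSL2F ⟨!![(ε : 𝓞 F), 0; 0, ((ε⁻¹ : (𝓞 F)ˣ) : 𝓞 F)], cpc_det_diagUnit ε⟩ : SL(2, F)) :
        Matrix (Fin 2) (Fin 2) F) = !![((ε : 𝓞 F) : F), 0; 0, (((ε⁻¹ : (𝓞 F)ˣ) : 𝓞 F) : F)] := by
  ext i j
  fin_cases i <;> fin_cases j <;> rfl

/-- The image of `E₁₂(a) ∈ SL₂(𝓞 F)` in `SL₂(F)` is the matrix `(1 a; 0 1)`. -/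
theorem cpc_coe_toSL2F_e12 {F : Type*} [Field F] [NumberField F] (a : 𝓞 F) :
    ((toSL2F (SL2Rel.e12 a) : SL(2, F)) : Matrix (Fin 2) (Fin 2) F) = !![1, (a : F); 0, 1] := by
  rw [show toSL2F (SL2Rel.e12 a) = SL2Rel.e12 (a : F) from SL2Rel.map_e12 _ a]
  rfl

/-- **Stub M-A3 (`stub_conj_principal_congruence`).** For `g ∈ SL₂(F)` and a non-zero ideal `𝔫` of
`𝓞 F` there is a non-zero ideal `𝔪` such that `g⁻¹ Γ(𝔫) g` contains the translations `(1 a; 0 1)`,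
`a ∈ 𝔪`, and the diagonal matrices `diag(ε, ε⁻¹)` of the units `ε ≡ 1 (mod 𝔪)`: for each such `t`
there is `γ ∈ Γ(𝔫)` with `γ g = g t` in `SL₂(F)`.  (Take `𝔪 = D²𝔫` for a common denominator `D` of
the entries of `g`; Freitag, *Hilbert Modular Forms*, Ch. I §3.) -/
theorem stub_conj_principal_congruence (F : Type) [Field F] [NumberField F] (𝔫 : Ideal (𝓞 F))
    (h𝔫 : 𝔫 ≠ ⊥) (g : SL(2, F)) :
    ∃ 𝔪 : Ideal (𝓞 F), 𝔪 ≠ ⊥ ∧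
      (∀ a : 𝓞 F, a ∈ 𝔪 → ∃ t : SL(2, F), (t : Matrix (Fin 2) (Fin 2) F) = !![1, (a : F); 0, 1] ∧
        ∃ γ ∈ Bianchi.Gamma 𝔫, toSL2F γ * g = g * t) ∧
      (∀ ε : (𝓞 F)ˣ, (ε : 𝓞 F) - 1 ∈ 𝔪 → ∃ t : SL(2, F),
        (t : Matrix (Fin 2) (Fin 2) F) = !![((ε : 𝓞 F) : F), 0; 0, (((ε⁻¹ : (𝓞 F)ˣ) : 𝓞 F) : F)] ∧
        ∃ γ ∈ Bianchi.Gamma 𝔫, toSL2F γ * g = g * t) := by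
  -- `𝔪 = D²𝔫 ≠ 0` with `g Γ(𝔪) g⁻¹ ⊆ Γ(𝔫)` inside `SL₂(F)` (tree: `SL2Rel.exists_conj_Gamma`)
  obtain ⟨𝔪, h𝔪, -, hconj⟩ := SL2Rel.exists_conj_Gamma (R := 𝓞 F) g h𝔫
  refine ⟨𝔪, h𝔪, fun a ha ↦ ?_, fun ε hε ↦ ?_⟩
  · obtain ⟨γ, hγ, hγeq⟩ := hconj (SL2Rel.e12 a) (SL2Rel.e12_mem_Gamma ha)
    refine ⟨toSL2F (SL2Rel.e12 a), cpc_coe_toSL2F_e12 a, γ, hγ, ?_⟩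
    have e : toSL2F γ = g * toSL2F (SL2Rel.e12 a) * g⁻¹ := hγeq
    rw [e, inv_mul_cancel_right]
  · obtain ⟨γ, hγ, hγeq⟩ := hconj _ (cpc_diagUnit_mem_Gamma hε)
    refine ⟨toSL2F ⟨!![(ε : 𝓞 F), 0; 0, ((ε⁻¹ : (𝓞 F)ˣ) : 𝓞 F)], cpc_det_diagUnit ε⟩,
      cpc_coe_toSL2F_diagUnit ε, γ, hγ, ?_⟩
    have e : toSL2F γ = g * toSL2F ⟨!![(ε : 𝓞 F), 0; 0, ((ε⁻¹ : (𝓞 F)ˣ) : 𝓞 F)],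
        cpc_det_diagUnit ε⟩ * g⁻¹ := hγeq
    rw [e, inv_mul_cancel_right]

end Summit.Langlands.Langlands.Theorems.HilbertIntegralOverconvergentIsCongruence
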